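import Summits.Parity.BatemanHorn.Theorems.RoughParitySectorsOddSectorShareNonlinearCoordinates

/-!
# Route `RoughParitySectors`, crux `OddSectorShareNonlinear` (stmt-Parity-15628): ONE polynomial —
# the crux in LIOUVILLE coordinates — by the line lead (c3)

Everything here is PROVED (no `sorry`, no new definition, no new fact); it supports the crux
`OddSectorShareNonlinear` without closing it, continuing
`RoughParitySectorsOddSectorShareNonlinearCoordinates.lean` (the crux per system `↔` "Bateman–Horn
ratio `c₁(log x)^k/(m x)` = parity ratio `2^k c_odd/#R`", no convergence hypothesis).

For a system of ONE polynomial `g = f 0` (`f : Fin 1 → ℤ[X]`) the parity ratio is a Liouville mean: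
`2·c_odd = #R − Σ_{n ∈ R} λ(g(n))` (`λ = (−1)^Ω` on the positive values `g(n)`; Mathlib's
`ArithmeticFunction.liouville`), so the coordinate statement `D_f` reads

  `|c₁·log x·#R − (#R − Σ_{n∈R} λ(g(n)))·(m·x)| ≤ ε·(#R − Σ_{n∈R} λ(g(n)))·(m·x)`, `m = C(g)/deg g`,

informally `π_g(x)·log x/(m·x) − 1 = −(Σ_{n∈R_g(x,U)} λ(g(n)))/#R_g(x,U) + o(1)` in the iterated limit
"`x → ∞`, then `U → ∞`": the relative Bateman–Horn error of `g` IS minus the normalised Liouville sum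
over the `x^{deg g/U}`-rough values of `g`.  The sibling crux `RoughParityBalance` for `g` says this
Liouville mean is `o(1)` ("Alladi along `g`"); then, and only then, the crux for `g` is Bateman–Horn
for `g` (cf. `Exactness.share_iff_asymptotic_of_balance`).

* `Coordinates.card_sub_liouville_eq_two_mul_oddSector` — `#R − Σ_{n∈R} λ(g(n)) = 2·c_odd`;
* `Coordinates.share_iff_liouville` — `A_f ↔` the Liouville form, for every one-polynomial system;
* `liouville_coordinates_of_oddSectorShareNonlinear` — the crux BY NAME `⟹` the Liouville form for
  every one-polynomial system of degree `≥ 2` (e.g. `X² + 1`).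

References: K. Alladi, Quart. J. Math. 33 (1982) [Alladi1982]; K. Alladi, J. Number Theory (1982)
(Möbius/Liouville over integers with large prime factors) [Alladi1982Moebius]; Bateman–Horn, Math.
Comp. 16 (1962) [BatemanHorn1962].
-/

namespace Summit.Parity.BatemanHorn.Cruxes.OddSectorShareNonlinear.Birth

open Filter Finset Polynomial
open scoped Topology
open Literature.NumberTheory.Sieve
open Summit.Parity.BatemanHorn.Theorems.RoughCountBand

/-! ### One polynomial (`k = 1`): the crux in Liouville coordinates -/

namespace Coordinates

/-- `#R − Σ_{n∈R} λ(g(n)⁺) = 2·c_odd` for a one-polynomial system (`g = f 0`; on `R` every `g(n) > 0`,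
so `λ(g(n)⁺) = (−1)^{Ω(g(n)⁺)}`). [folklore] -/
theorem card_sub_liouville_eq_two_mul_oddSector (f : Fin 1 → ℤ[X]) (x : ℕ) (U : ℝ) :
    ((((Finset.Icc 1 x).filter (fun n : ℕ => ∀ i, 0 < (f i).eval (n : ℤ) ∧
        ∀ p ∈ Finset.range ⌈(x : ℝ) ^ (((f i).natDegree : ℝ) / U)⌉₊, p.Prime →
          ¬ ((p : ℤ) ∣ (f i).eval (n : ℤ)))).card : ℕ) : ℝ) -
      ∑ n ∈ (Finset.Icc 1 x).filter (fun n : ℕ => ∀ i, 0 < (f i).eval (n : ℤ) ∧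
        ∀ p ∈ Finset.range ⌈(x : ℝ) ^ (((f i).natDegree : ℝ) / U)⌉₊, p.Prime →
          ¬ ((p : ℤ) ∣ (f i).eval (n : ℤ))),
        ((ArithmeticFunction.liouville (((f 0).eval (n : ℤ)).toNat) : ℤ) : ℝ) =
    2 * (((((Finset.Icc 1 x).filter (fun n : ℕ => ∀ i, 0 < (f i).eval (n : ℤ) ∧
        ∀ p ∈ Finset.range ⌈(x : ℝ) ^ (((f i).natDegree : ℝ) / U)⌉₊, p.Prime →
          ¬ ((p : ℤ) ∣ (f i).eval (n : ℤ)))).filter (fun n : ℕ => ∀ i,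
        Odd (ArithmeticFunction.cardFactors (((f i).eval (n : ℤ)).toNat)))).card : ℕ) : ℝ) := by
  set R := (Finset.Icc 1 x).filter (fun n : ℕ => ∀ i, 0 < (f i).eval (n : ℤ) ∧
    ∀ p ∈ Finset.range ⌈(x : ℝ) ^ (((f i).natDegree : ℝ) / U)⌉₊, p.Prime →
      ¬ ((p : ℤ) ∣ (f i).eval (n : ℤ))) with hR
  have hpos : ∀ n ∈ R, 0 < (f 0).eval (n : ℤ) := fun n hn => ((Finset.mem_filter.1 hn).2 0).1
  -- both sides are sums over `R`
  rw [Finset.card_eq_sum_ones R, Nat.cast_sum, ← Finset.sum_sub_distrib, Finset.card_filter,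
    Nat.cast_sum, Finset.mul_sum]
  refine Finset.sum_congr rfl fun n hn => ?_
  have h0 : (((f 0).eval (n : ℤ)).toNat) ≠ 0 := by
    intro h; rw [Int.toNat_eq_zero] at h; exact absurd (hpos n hn) (not_lt.mpr h)
  rw [ArithmeticFunction.liouville_apply h0]
  push_cast
  by_cases hodd : Odd (ArithmeticFunction.cardFactors (((f 0).eval (n : ℤ)).toNat))
  · have hall : ∀ i : Fin 1, Odd (ArithmeticFunction.cardFactors (((f i).eval (n : ℤ)).toNat)) :=
      Fin.forall_fin_one.2 hodd
    rw [if_pos hall, hodd.neg_one_pow]; norm_num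
  · have hall : ¬ ∀ i : Fin 1, Odd (ArithmeticFunction.cardFactors (((f i).eval (n : ℤ)).toNat)) :=
      fun h => hodd (h 0)
    rw [if_neg hall, (Nat.not_odd_iff_even.1 hodd).neg_one_pow]; norm_num

/-- **`A_f ↔` Liouville coordinates, one polynomial.**  For a Bateman–Horn system of ONE polynomial
`g = f 0` (any degree) the odd-sector share statement of the cruxes `OddSectorShare*` for `f` is
equivalent to: for every `ε > 0` there is `U₀` such that for every `U ≥ U₀`, eventually in `x`,
`|c₁·log x·#R − (#R − Σ_{n∈R} λ(g(n)))·(m·x)| ≤ ε·(#R − Σ_{n∈R} λ(g(n)))·(m·x)` (`m = C(g)/deg g`,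
`R = R_g(x,U)` the `x^{deg g/U}`-rough values): the relative Bateman–Horn error of `g` is minus the
normalised Liouville sum over the rough values of `g`, up to `o(1)`. [folklore] -/
theorem share_iff_liouville {f : Fin 1 → ℤ[X]} (hf : IsBatemanHornSystem f) :
    (∀ η : ℝ, 0 < η → ∃ U₀ : ℝ, ∀ U : ℝ, U₀ ≤ U → ∀ᶠ x : ℕ in Filter.atTop,
      |(((((Finset.Icc 1 x).filter (fun n : ℕ => ∀ i, 0 < (f i).eval (n : ℤ) ∧
          ∀ p ∈ Finset.range ⌈(x : ℝ) ^ (((f i).natDegree : ℝ) / U)⌉₊, p.Prime →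
            ¬ ((p : ℤ) ∣ (f i).eval (n : ℤ)))).filter (fun n : ℕ => ∀ i,
          ArithmeticFunction.cardFactors (((f i).eval (n : ℤ)).toNat) = 1)).card : ℕ) : ℝ) *
          (U * Real.exp (-Real.eulerMascheroniConstant) / 2) ^ 1 -
        (((((Finset.Icc 1 x).filter (fun n : ℕ => ∀ i, 0 < (f i).eval (n : ℤ) ∧
          ∀ p ∈ Finset.range ⌈(x : ℝ) ^ (((f i).natDegree : ℝ) / U)⌉₊, p.Prime →
            ¬ ((p : ℤ) ∣ (f i).eval (n : ℤ)))).filter (fun n : ℕ => ∀ i,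
          Odd (ArithmeticFunction.cardFactors (((f i).eval (n : ℤ)).toNat)))).card : ℕ) : ℝ)| ≤
        η * (((((Finset.Icc 1 x).filter (fun n : ℕ => ∀ i, 0 < (f i).eval (n : ℤ) ∧
          ∀ p ∈ Finset.range ⌈(x : ℝ) ^ (((f i).natDegree : ℝ) / U)⌉₊, p.Prime →
            ¬ ((p : ℤ) ∣ (f i).eval (n : ℤ)))).filter (fun n : ℕ => ∀ i,
          Odd (ArithmeticFunction.cardFactors (((f i).eval (n : ℤ)).toNat)))).card : ℕ) : ℝ)) ↔
    (∀ ε : ℝ, 0 < ε → ∃ U₀ : ℝ, ∀ U : ℝ, U₀ ≤ U → ∀ᶠ x : ℕ in Filter.atTop,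
      |(((((Finset.Icc 1 x).filter (fun n : ℕ => ∀ i, 0 < (f i).eval (n : ℤ) ∧
          ∀ p ∈ Finset.range ⌈(x : ℝ) ^ (((f i).natDegree : ℝ) / U)⌉₊, p.Prime →
            ¬ ((p : ℤ) ∣ (f i).eval (n : ℤ)))).filter (fun n : ℕ => ∀ i,
          ArithmeticFunction.cardFactors (((f i).eval (n : ℤ)).toNat) = 1)).card : ℕ) : ℝ) *
          Real.log x *
          ((((Finset.Icc 1 x).filter (fun n : ℕ => ∀ i, 0 < (f i).eval (n : ℤ) ∧
            ∀ p ∈ Finset.range ⌈(x : ℝ) ^ (((f i).natDegree : ℝ) / U)⌉₊, p.Prime →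
              ¬ ((p : ℤ) ∣ (f i).eval (n : ℤ)))).card : ℕ) : ℝ) -
        (((((Finset.Icc 1 x).filter (fun n : ℕ => ∀ i, 0 < (f i).eval (n : ℤ) ∧
            ∀ p ∈ Finset.range ⌈(x : ℝ) ^ (((f i).natDegree : ℝ) / U)⌉₊, p.Prime →
              ¬ ((p : ℤ) ∣ (f i).eval (n : ℤ)))).card : ℕ) : ℝ) -
          ∑ n ∈ (Finset.Icc 1 x).filter (fun n : ℕ => ∀ i, 0 < (f i).eval (n : ℤ) ∧
            ∀ p ∈ Finset.range ⌈(x : ℝ) ^ (((f i).natDegree : ℝ) / U)⌉₊, p.Prime →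
              ¬ ((p : ℤ) ∣ (f i).eval (n : ℤ))),
            ((ArithmeticFunction.liouville (((f 0).eval (n : ℤ)).toNat) : ℤ) : ℝ)) *
          (batemanHornConst f / ((f 0).natDegree : ℝ) * x)| ≤
        ε * (((((((Finset.Icc 1 x).filter (fun n : ℕ => ∀ i, 0 < (f i).eval (n : ℤ) ∧
            ∀ p ∈ Finset.range ⌈(x : ℝ) ^ (((f i).natDegree : ℝ) / U)⌉₊, p.Prime →
              ¬ ((p : ℤ) ∣ (f i).eval (n : ℤ)))).card : ℕ) : ℝ) -
          ∑ n ∈ (Finset.Icc 1 x).filter (fun n : ℕ => ∀ i, 0 < (f i).eval (n : ℤ) ∧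
            ∀ p ∈ Finset.range ⌈(x : ℝ) ^ (((f i).natDegree : ℝ) / U)⌉₊, p.Prime →
              ¬ ((p : ℤ) ∣ (f i).eval (n : ℤ))),
            ((ArithmeticFunction.liouville (((f 0).eval (n : ℤ)).toNat) : ℤ) : ℝ)) *
          (batemanHornConst f / ((f 0).natDegree : ℝ) * x)))) := by
  refine (share_iff_coordinates hf).trans ?_
  refine forall₂_congr fun ε _ => exists_congr fun U₀ => forall₂_congr fun U _ => ?_
  refine Filter.eventually_congr (Filter.Eventually.of_forall fun x => ?_)
  rw [card_sub_liouville_eq_two_mul_oddSector f x U, pow_one, pow_one, Fin.prod_univ_one]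

end Coordinates

/-- **The crux along ONE nonlinear polynomial, in Liouville coordinates.**  The route decl
`Theses.RoughParitySectors.OddSectorShareNonlinear` implies, for every Bateman–Horn system of one
polynomial `g = f 0` of degree `≥ 2` (e.g. `X² + 1`): for every `ε > 0` there is `U₀` such that for
every `U ≥ U₀`, eventually in `x`,
`|c₁·log x·#R − (#R − Σ_{n∈R} λ(g(n)))·(m·x)| ≤ ε·(#R − Σ_{n∈R} λ(g(n)))·(m·x)` with `m = C(g)/deg g`
and `R = {n ≤ x : g(n) > 0, g(n) has no prime factor < ⌈x^{deg g/U}⌉}`; informally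
`π_g(x)·log x/(m·x) − 1 = −(Σ_{n∈R} λ(g(n)))/#R + o(1)`: whatever the prime count of `g` does
relative to Bateman–Horn is dictated by the Liouville bias of the rough values of `g`, and vice versa.
[folklore] -/
theorem liouville_coordinates_of_oddSectorShareNonlinear :
    Summit.Parity.BatemanHorn.Theses.RoughParitySectors.OddSectorShareNonlinear →
    ∀ (f : Fin 1 → Polynomial ℤ), IsBatemanHornSystem f → 2 ≤ (f 0).natDegree →
    ∀ ε : ℝ, 0 < ε → ∃ U₀ : ℝ, ∀ U : ℝ, U₀ ≤ U → ∀ᶠ x : ℕ in Filter.atTop,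
      |(((((Finset.Icc 1 x).filter (fun n : ℕ => ∀ i, 0 < (f i).eval (n : ℤ) ∧
          ∀ p ∈ Finset.range ⌈(x : ℝ) ^ (((f i).natDegree : ℝ) / U)⌉₊, p.Prime →
            ¬ ((p : ℤ) ∣ (f i).eval (n : ℤ)))).filter (fun n : ℕ => ∀ i,
          ArithmeticFunction.cardFactors (((f i).eval (n : ℤ)).toNat) = 1)).card : ℕ) : ℝ) *
          Real.log x *
          ((((Finset.Icc 1 x).filter (fun n : ℕ => ∀ i, 0 < (f i).eval (n : ℤ) ∧
            ∀ p ∈ Finset.range ⌈(x : ℝ) ^ (((f i).natDegree : ℝ) / U)⌉₊, p.Prime →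
              ¬ ((p : ℤ) ∣ (f i).eval (n : ℤ)))).card : ℕ) : ℝ) -
        (((((Finset.Icc 1 x).filter (fun n : ℕ => ∀ i, 0 < (f i).eval (n : ℤ) ∧
            ∀ p ∈ Finset.range ⌈(x : ℝ) ^ (((f i).natDegree : ℝ) / U)⌉₊, p.Prime →
              ¬ ((p : ℤ) ∣ (f i).eval (n : ℤ)))).card : ℕ) : ℝ) -
          ∑ n ∈ (Finset.Icc 1 x).filter (fun n : ℕ => ∀ i, 0 < (f i).eval (n : ℤ) ∧
            ∀ p ∈ Finset.range ⌈(x : ℝ) ^ (((f i).natDegree : ℝ) / U)⌉₊, p.Prime →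
              ¬ ((p : ℤ) ∣ (f i).eval (n : ℤ))),
            ((ArithmeticFunction.liouville (((f 0).eval (n : ℤ)).toNat) : ℤ) : ℝ)) *
          (batemanHornConst f / ((f 0).natDegree : ℝ) * x)| ≤
        ε * (((((((Finset.Icc 1 x).filter (fun n : ℕ => ∀ i, 0 < (f i).eval (n : ℤ) ∧
            ∀ p ∈ Finset.range ⌈(x : ℝ) ^ (((f i).natDegree : ℝ) / U)⌉₊, p.Prime →
              ¬ ((p : ℤ) ∣ (f i).eval (n : ℤ)))).card : ℕ) : ℝ) -
          ∑ n ∈ (Finset.Icc 1 x).filter (fun n : ℕ => ∀ i, 0 < (f i).eval (n : ℤ) ∧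
            ∀ p ∈ Finset.range ⌈(x : ℝ) ^ (((f i).natDegree : ℝ) / U)⌉₊, p.Prime →
              ¬ ((p : ℤ) ∣ (f i).eval (n : ℤ))),
            ((ArithmeticFunction.liouville (((f 0).eval (n : ℤ)).toNat) : ℤ) : ℝ)) *
          (batemanHornConst f / ((f 0).natDegree : ℝ) * x))) :=
  fun hA f hf hd => (Coordinates.share_iff_liouville hf).1 (hA 1 f hf ⟨0, hd⟩)

end Summit.Parity.BatemanHorn.Cruxes.OddSectorShareNonlinear.Birth
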